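import Summits.QuantumFields.BalabanUV.T4Continuum.Support.NE7EtaBackgroundLevelSmallDischarge
import Summits.QuantumFields.BalabanUV.T4Continuum.Support.NE7EtaBackgroundTowerRate
import HarnessLib

/-!
# NE7EtaBackgroundOfRegularMinimisers — route #1 of the NE7 crux, stub S7 (NODE O, the BACKGROUND COORDINATE): the `hclose` chain and its
# tower docking RE-CUT on row NE3's (H∃) `hmin` BY NAME — «all minimisers regular» (H3ˢᵘᵖ) weakened to «a regular minimiser exists at every
# level», the (H2)∕SmoothRefine thresholds and the auxiliary data class GONE

Cell `pub-balaban`, rung (B)+1 sub-cell t4, lineage `b2b-balaban-t4-ne7-p1`, generation 54 (CRUX PROVER NE7 #1, ruling e34b3e0c (2)); crux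
skeleton `t4/skeletons/NE7-CRUX-R1.md` v1.7.12 §0bis item 7 ∕ §5 (G5).  HONEST FRAMING (page 1): FIXED FINITE T⁴, rung (B)+1; NE7, NE3 NOT
PRINTED in [Balaban1984PropagatorsI]–[Balaban1989LargeFieldII] and NOT PROVED here; continuum YM on T⁴ ⇐ BetaPertH ∧ nine spine estimates
(0/9 proved); BetaPertH ⇐ (D1) ∧ (D4) ∧ CAP+tail; G-an2-4 gates asym, D1 and NE2/3/4; NOT infinite volume, NOT mass gap, NOT Clay.

WHAT ([folklore]; 0 def; 0 sorry).  The background coordinate's `hclose` binder of record (`NE7EtaBackgroundCloseness.hclose_of_covRoot_occ`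
p258604 → `…GaugeLetterDischarge` p263433 → `…RefineDischarge` p266066 → `…LevelSmallDischarge.hclose_of_regularSup_lines` p310675) asks row NE3
for (H3ˢᵘᵖ) in its UNIVERSAL form `h3 : ∀ V ∈ dom, ∀ k U, IsMinimiser 4 (sfClass 4 L N ε) L N (k+1) V U → RegularSup 4 L N b c (k+1) U`
(«EVERY minimiser of every run `k+1` is sup-regular») and pays for the EXISTENCE of the minimiser pair with the (H2)∕`SmoothRefine` road
(compactness `MinimalActionExistence`, kinematic refinement `NE7EtaBackgroundRefineThresholds`): radii `0 ≤ b, c ≤ t`, `2^91·L^17·t ≤ 1`,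
`2^76·L^12·t ≤ ε`, `1024·5·8·L²·ε ≤ 1`, an auxiliary data class `dom ⊆ sfClass 4 L N ε₁ 0` (`ε₁ ≤ 1∕4`, `ε₁ ≤ b`, `4ε₁ ≤ c`).  Row NE3's OWN
END of record for the action half, `MinimalActionThm1Type.actionRate_sfClass_thm1Type`, asks instead the EXISTENTIAL form (H∃)
`hmin : ∀ V ∈ dom, ∀ k, ∃ U, IsMinimiser d (sfClass d L N ε) L N k V U ∧ RegularSup d L N b c k U` («at every level SOME minimiser is
sup-regular» — the existence clause (8) + (10) of [Balaban1985Variational] Thm 1 p. 279 TYPE, read literally; asserted for nothing).  THIS FILE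
re-cuts the chain on `hmin` (d = 4):
 * `hexA_of_hmin`, `hexB_of_hmin` — the two existence binders of p258604 from `hmin` (run A: drop the regularity; run B: `RegularSup.regular` +
   `Regular.mono` at any `g ≥ gradConst 4 c`, and the torus-gauge letter `NE7EtaBackgroundGaugeLetterDischarge.hletter_holds`, `σ_B =
   gaugeConst n·(N⁻¹ + N·b)`, under `0 ≤ b ≤ ε` and the sector condition);
 * **`hclose_of_hmin`** — the `hclose` binder on `occCarriers` from: NE3's covariant root `h` (INTERFACE REQUEST NE7→NE3 amendment 4, VERBATIM),
   NE3's (H∃) `hmin` (VERBATIM the binder of `actionRate_sfClass_thm1Type` at `d = 4`), `hdom`, the closed-form numeric letters `16·C₀·ε ≤ 3`,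
   `2·twoLevelSmall 4 L·ε ≤ L²`, `512·5·8·L²·b ≤ 1`, `0 ≤ b ≤ ε`, `gradConst 4 c ≤ g`, the budget letters `hγ3`∕`hΛl₁`, and the sector
   condition `|n|·N²·ε ≤ sectorConst n`.  GONE relative to p310675: `h3` (universal form), `t`, `2^91·L^17·t ≤ 1`, `2^76·L^12·t ≤ ε`,
   `1024·5·8·L²·ε ≤ 1`, `ε₁` and `dom ⊆ sfClass 4 L N ε₁ 0`.  Conclusion VERBATIM that of p258604∕p310675;
 * **`uRateUpTo_occCarriers_of_hmin`** — the DOCKING (node U3's rate along the tower, `T4TowerRateComposition.URateUpTo K` for every cutoff) on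
   `occCarriers` from the same hypotheses + node U3's shapes on the carrier + node U2's `InjectedRate` (`hclose_of_hmin` ∘
   `NE7EtaBackgroundTowerRate.uRateUpTo_of_hclose`; the gen-25 docking p259051 re-derived on the reduced bill);
 * `hmin_of_regularSup_four` — THE OLD BILL IMPLIES THE NEW: under p310675's hypotheses (`h3` universal + data class + thresholds + compactness
   regime) `hmin` holds (`NE7EtaBackgroundRefineThresholds.exists_regular_isMinimiser_thm1Type` at `d = 4` with `thresholds_four` ∕
   `classRadius_four`), so p310675 is the composition `hclose_of_hmin ∘ hmin_of_regularSup_four` and this re-cut is a GENERALISATION, not a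
   change of subject.
CONSEQUENCE FOR THE BILL (skeleton §0bis item 7): NODE O's background coordinate — closeness AND docking — now costs EXACTLY row NE3's covariant
root (amendment 4) + row NE3's (H∃) IN THE CURRENCY OF NE3's OWN END (one hypothesis name serves both rows) + closed-form numerics + `hdom` +
`hγ3`∕`hΛl₁` + the sector condition.  Nothing in the ask of NE3's root, nothing in the composition changes; route 1 stays KERNEL-COMPLETE AT
FORM LEVEL ∕ DEPENDENT; NE7 NOT proved.  HONEST: bookkeeping; (H∃) and the root are HYPOTHESES asserted for no configuration; the weakening
«∀ minimisers regular → ∃ a regular minimiser» removes the tacit uniqueness flavour of `h3` but discharges nothing of Bałaban's; 0 def; 0 sorry.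
-/

set_option autoImplicit false

open scoped BigOperators Matrix Matrix.Norms.L2Operator
open Finset NormedSpace

namespace Summit.QuantumFields.BalabanUV.T4Continuum.NE7EtaBackgroundOfRegularMinimisers

open Literature.MathematicalPhysics.QuantumFieldTheory.Balaban1983to89
open B7Prop1Explicit B7Prop2Explicit
open T4AveragingDeficitWall hiding Site Plane Plaq Bond
open T4AveragingDeficitWallBoundary (periodBox IsPeriodicCfg)
open MinimalActionSandwich (IsMinimiser)
open MinimalActionRate (Regular sfClass)
open MinimalActionRefine (RegularSup gradConst gradConst_nonneg)
open T4OutputRate (Carriers Functional NE9 NE5 LipBackground FadingMemory)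
open T4TowerRateComposition (PolyLipGrowth URateUpTo)
open T4CauchySum (InjectedRate)
open AveragingDeficitPeriodicCounting (IsPeriodicDir)
open AveragingDeficitTwoLevelPrep (twoLevelSmall)
open AveragingDeficitMultiLevelPrep (LevelSmall)
open NE3EnergyShapes (residualScale IsUnitarySite IsPeriodicSite)
open NE3EnergyWeightedShapes (energyNormW)
open AveragingDeficitDualResidual (dualC1 dualC2)
open AveragingDeficitDerivWallProof (wallConst)
open SkeletonPrecompGrad (gradRem)
open NE7EtaBackgroundCarrier NE7EtaBackgroundCloseness
open TorusSmallFieldGlobalGauge (sectorConst gaugeConst sectorConst_pos)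
open NE7EtaBackgroundGaugeLetterDischarge (hletter_holds)
open NE7EtaBackgroundLevelSmallDischarge (levelSmall_hls)
open NE7EtaBackgroundTowerRate (uRateUpTo_of_hclose)
open NE7EtaBackgroundRefineThresholds (exists_regular_isMinimiser_thm1Type thresholds_four classRadius_four)

noncomputable section

variable {n : Type} [Fintype n] [DecidableEq n] [Nonempty n]

/-! ## §1 The two existence binders of p258604 from (H∃) -/

omit [Nonempty n] in
/-- **`hexA` FROM (H∃)**: run-A minimisers exist at every level for every datum of `dom` — the first conjunct of `hmin` (its regularity
conjunct is not needed for run A). [folklore] -/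
theorem hexA_of_hmin {L N : ℕ} {ε b c : ℝ} {dom : Set (Site 4 → Fin 4 → (Matrix n n ℂ)ˣ)}
    (hmin : ∀ V ∈ dom, ∀ k : ℕ, ∃ U, IsMinimiser 4 (sfClass 4 L N ε) L N k V U ∧ RegularSup 4 L N b c k U) :
    ∀ K : ℕ, 1 ≤ K → ∀ v ∈ dom, ∃ UA : Site 4 → Fin 4 → (Matrix n n ℂ)ˣ, IsMinimiser 4 (sfClass 4 L N ε) L N K v UA := by
  intro K _ v hv
  obtain ⟨U, hU, -⟩ := hmin v hv K
  exact ⟨U, hU⟩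

/-- **`hexB` FROM (H∃) AND THE TORUS GAUGE** (`L ≥ 2`, `N ≥ 1`, `θ⁶ = L⁻¹`, `0 ≤ b ≤ ε`, `gradConst 4 c ≤ g`): for `K ≥ 1` and `v ∈ dom`, under
the sector condition `|n|·N²·ε ≤ sectorConst n`, the sup-regular run-`(K+1)` minimiser of `hmin` is `Regular 4 L N b g (K+1)`
(`RegularSup.regular`, `Regular.mono`) and, in SOME unitary `N·L^{K+1}`-periodic gauge, bondwise `exp A_B` with
`‖A_B‖ ≤ gaugeConst n·(N⁻¹ + N·b)·θ^{6(K+1)}` (`NE7EtaBackgroundGaugeLetterDischarge.hletter_holds`, i.e. `TorusSmallFieldGlobalGauge`) — literally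
the binder `hexB` of `NE7EtaBackgroundCloseness.hclose_of_covRoot_occ` with `σ_B = gaugeConst n·(N⁻¹ + N·b)`, `c₀ = sectorConst n`. [folklore] -/
theorem hexB_of_hmin {L N : ℕ} (hL : 2 ≤ L) (hN : 1 ≤ N) {θ : ℝ} (hθ6 : θ ^ 6 = ((L : ℝ))⁻¹) {ε b c g : ℝ}
    (hb : 0 ≤ b) (hbε : b ≤ ε) (hgc : gradConst 4 c ≤ g) {dom : Set (Site 4 → Fin 4 → (Matrix n n ℂ)ˣ)}
    (hmin : ∀ V ∈ dom, ∀ k : ℕ, ∃ U, IsMinimiser 4 (sfClass 4 L N ε) L N k V U ∧ RegularSup 4 L N b c k U) :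
    ∀ K : ℕ, 1 ≤ K → ∀ v ∈ dom, (Fintype.card n : ℝ) * (N : ℝ) ^ 2 * ε ≤ sectorConst n →
      ∃ UB : Site 4 → Fin 4 → (Matrix n n ℂ)ˣ, IsMinimiser 4 (sfClass 4 L N ε) L N (K + 1) v UB ∧ Regular 4 L N b g (K + 1) UB ∧
        ∃ uB : Site 4 → (Matrix n n ℂ)ˣ, IsUnitarySite uB ∧ IsPeriodicSite uB ((N * L ^ (K + 1) : ℕ) : ℤ) ∧
          ∃ AB : Site 4 → Fin 4 → Matrix n n ℂ, ∀ (x : Site 4) (κ : Fin 4),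
            ((gaugeAct uB UB x κ : (Matrix n n ℂ)ˣ) : Matrix n n ℂ) = exp (AB x κ) ∧
              ‖AB x κ‖ ≤ (gaugeConst n * (((N : ℝ))⁻¹ + (N : ℝ) * b)) * θ ^ (6 * (K + 1)) := by
  intro K hK v hv hsec
  obtain ⟨UB, hUB, hregs⟩ := hmin v hv (K + 1)
  have hreg : Regular 4 L N b g (K + 1) UB := (hregs.regular).mono le_rfl hgc
  obtain ⟨uB, hu, huP, AB, hAB⟩ := hletter_holds (dom := dom) hL hN hθ6 hb hbε K hK v hv UB hUB hreg hsec
  exact ⟨UB, hUB, hreg, uB, hu, huP, AB, hAB⟩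

/-! ## §2 The `hclose` binder on the occurring classes from NE3's root + (H∃) + closed-form letters -/

/-- **NODE O's `hclose` BINDER RE-CUT ON (H∃)** — `NE7EtaBackgroundCloseness.hclose_of_covRoot_occ` (p258604) with `hexA`∕`hexB` DISCHARGED from
row NE3's (H∃) `hmin` (VERBATIM the binder of `MinimalActionThm1Type.actionRate_sfClass_thm1Type` at `d = 4`) and the torus gauge, and the K-free
`LevelSmall` family from two closed-form lines (`NE7EtaBackgroundLevelSmallDischarge.levelSmall_hls`).  REMAINING HYPOTHESES (all displayed): row
NE3's covariant root `h` (INTERFACE REQUEST NE7→NE3 amendment 4, VERBATIM as in p258604), row NE3's (H∃) `hmin` ([Balaban1985Variational] Thm 1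
(8)+(10) p. 279 existence clause TYPE — a hypothesis SHAPE asserted for no configuration), `0 ≤ b ≤ ε`, `512·5·8·L²·b ≤ 1`, `16·C₀·ε ≤ 3`,
`2·twoLevelSmall 4 L·ε ≤ L²`, `gradConst 4 c ≤ g`, `0 ≤ C`, `0 < Λ₂′`, `hdom`, the budget letters `hγ3`∕`hΛl₁`, and the sector condition
`|n|·N²·ε ≤ sectorConst n` (NEEDS-SIDE-CONDITION #S1).  Conclusion VERBATIM that of p258604 ∕ p310675.  NE3∕NE7 NOT proved. [folklore] -/
theorem hclose_of_hmin {L N : ℕ} (hL : 2 ≤ L) (hN : 1 ≤ N) {θ : ℝ} (hθ : 0 < θ)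
    (hθ6 : θ ^ 6 = ((L : ℝ))⁻¹) {ε b c : ℝ} (hb : 0 ≤ b) (hbε : b ≤ ε)
    (hbs : 512 * (4 + 1) * (4 + 4) * (L : ℝ) ^ 2 * b ≤ 1)
    (hε1 : 16 * C0 4 * ε ≤ 3) (h2line : 2 * twoLevelSmall 4 L * ε ≤ (L : ℝ) ^ 2)
    {g C Λ₁ Λ₂' : ℝ} (hgc : gradConst 4 c ≤ g) (hC : 0 ≤ C) (hΛ₂' : 0 < Λ₂')
    {dom : Set (Site 4 → Fin 4 → (Matrix n n ℂ)ˣ)}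
    (hdom : ∀ v ∈ dom, ∀ w : Site 4 → (Matrix n n ℂ)ˣ, IsUnitarySite w → IsPeriodicSite w (N : ℤ) → gaugeAct w v ∈ dom)
    (hmin : ∀ V ∈ dom, ∀ k : ℕ, ∃ U, IsMinimiser 4 (sfClass 4 L N ε) L N k V U ∧ RegularSup 4 L N b c k U)
    (h : ∀ k : ℕ, 1 ≤ k → ∀ V ∈ dom, ∀ UA UB : Site 4 → Fin 4 → (Matrix n n ℂ)ˣ,
      IsMinimiser 4 (sfClass 4 L N ε) L N k V UA → IsMinimiser 4 (sfClass 4 L N ε) L N (k + 1) V UB →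
        Regular 4 L N b g (k + 1) UB →
        ∃ (u : Site 4 → (Matrix n n ℂ)ˣ) (Z : Site 4 → Fin 4 → Matrix n n ℂ),
          IsUnitarySite u ∧ IsPeriodicSite u ((N * L ^ k : ℕ) : ℤ) ∧
          IsSkewDir Z ∧ IsPeriodicDir Z ((N * L ^ k : ℕ) : ℤ) ∧
          gaugeAct u UA = vary (rescale L (bavg L UB)) Z 1 ∧
          energyNormW L k (rescale L (bavg L UB)) Z (periodBox (N * L ^ k)) ≤ C * residualScale 4 L N b g k ∧
          (∀ (κ : Fin 4) (x : Site 4) (μ : Fin 4),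
            ‖Ad (rescale L (bavg L UB) (x + e κ) μ) (Z (x + e μ) κ) - Z x κ‖ ≤ Λ₁ * (((L : ℝ)⁻¹) ^ k) ^ 2) ∧
          (∀ (κ μ : Fin 4) (y : Site 4),
            ‖Ad (rescale L (bavg L UB) (y + e κ) μ)
                (Ad (rescale L (bavg L UB) (y + e κ + e μ) μ) (Z (y + (2 : ℕ) • e μ) κ) - Z (y + e μ) κ)
              - (Ad (rescale L (bavg L UB) (y + e κ) μ) (Z (y + e μ) κ) - Z y κ)‖ ≤ Λ₂' * (((L : ℝ)⁻¹) ^ k) ^ 3))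
    {γ l₁ : ℝ} (hγ : 0 < γ)
    (hγ3 : C * (wallConst 4 L * (N : ℝ) ^ 2 * (Real.sqrt g * dualC2 4 L + 2 * b ^ 2 * dualC1 4 L)) ≤ γ ^ 3)
    (hl₁ : 0 < l₁) (hΛl₁ : Λ₁ ≤ l₁ ^ 3)
    (hsector : (Fintype.card n : ℝ) * (N : ℝ) ^ 2 * ε ≤ sectorConst n)
    (D : Type) (sc : D → ℕ) (dl : D → ℝ) (hdl : ∀ X, 0 ≤ dl X) :
    ∃ (uA : ℕ → (Site 4 → Fin 4 → (Matrix n n ℂ)ˣ) → (occCarriers n L N ε dom D sc dl hdl).BgA)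
      (uB : ℕ → (Site 4 → Fin 4 → (Matrix n n ℂ)ˣ) → (occCarriers n L N ε dom D sc dl hdl).BgB) (K₀ : ℕ) (C₃ : ℝ),
      0 ≤ C₃ ∧
      (∀ K : ℕ, K₀ ≤ K → ∀ v ∈ dom, ∃ (UA UB : Site 4 → Fin 4 → (Matrix n n ℂ)ˣ) (wA wB : Site 4 → (Matrix n n ℂ)ˣ),
        IsMinimiser 4 (sfClass 4 L N ε) L N K v UA ∧ IsMinimiser 4 (sfClass 4 L N ε) L N (K + 1) v UB ∧
        Regular 4 L N b g (K + 1) UB ∧ IsUnitarySite wA ∧ IsPeriodicSite wA ((N * L ^ K : ℕ) : ℤ) ∧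
        IsUnitarySite wB ∧ IsPeriodicSite wB ((N * L ^ (K + 1) : ℕ) : ℤ) ∧
        (uA K v).1 = (K, gaugeAct wA UA) ∧ (uB K v).1 = (K, gaugeAct wB UB)) ∧
      (∀ (K : ℕ) (v : Site 4 → Fin 4 → (Matrix n n ℂ)ˣ), ¬ (K₀ ≤ K ∧ v ∈ dom) →
        (uA K v).1 = (K, 1) ∧ (uB K v).1 = (K, 1)) ∧
      ∀ K : ℕ, ∀ v ∈ dom, (occCarriers n L N ε dom D sc dl hdl).gauge (uA K v)
          ((occCarriers n L N ε dom D sc dl hdl).transport (uB K v))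
        ≤ C₃ * θ ^ K := by
  have hε : 0 ≤ ε := hb.trans hbε
  have hg : 0 ≤ g := (gradConst_nonneg (d := 4) c).trans hgc
  have hN0 : (0 : ℝ) < N := by exact_mod_cast hN
  have hσB : 0 ≤ gaugeConst n * (((N : ℝ))⁻¹ + (N : ℝ) * b) := by
    have := (sectorConst_pos (n := n)).2
    positivity
  exact hclose_of_covRoot_occ hL hN hθ hθ6 hε (levelSmall_hls hL hε hε1 h2line) hb hbs hg hC hΛ₂' hdom h hγ hγ3 hl₁ hΛl₁
    (hexA_of_hmin hmin) hσB hsector (hexB_of_hmin hL hN hθ6 hb hbε hgc hmin) D sc dl hdl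

/-! ## §3 The docking: node U3's rate along the tower on the occurring classes, on the reduced bill -/

/-- **ROUTE #1's NODE-U3 RATE ALONG THE TOWER ON `occCarriers`, RE-CUT ON (H∃)** — the gen-25 docking
(`NE7EtaBackgroundTowerRate.uRateUpTo_bgCarriers_of_covRoot`, p259051) re-derived on the bill of `hclose_of_hmin`: its hypotheses (NE3's covariant
root amendment 4, NE3's (H∃) `hmin`, `hdom`, closed-form letters, sector condition) AND node U3's shapes on the carrier
`C = occCarriers n L N ε dom D sc dl hdl` — `NE9 EA W κ Λ` with `FadingMemory C₉ ω Λ`, `LipBackground EA W κ CU` with `PolyLipGrowth CU g P q`,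
`NE5 EA EB W κ θ₅ C₅` —, node U2's output `InjectedRate Cd 0 θc disc` for the tower table on the printed box, both runs' sequences in `W`, and
ANY common rate `θ'` with `max(ω, θc) < θ'`, `θ₅ ≤ θ'`, `θ = L^{−1∕6} ≤ θ'`.  CONCLUSION: selections `uA uB` (gauge copies of a minimiser pair
for the datum itself from `K₀` on, the trivial background below) and ONE `a ≥ 0` with
`URateUpTo K EA EB (g K) (g (K+1) (·+1)) (uA K) (uB K) dom (a + C₉(γ³Cd)θ'∕(θ' − max(ω,θc)) + C₅) θ' κ` FOR EVERY CUTOFF `K`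
(`hclose_of_hmin` ∘ `uRateUpTo_of_hclose`).  HONEST: every analytic input (NE3's root, (H∃), NE9, the Lipschitz bracket, NE5, node U2's rate)
is a HYPOTHESIS; the functionals `EA`, `EB` are ABSTRACT (NODE O's functional half, ownerless); nothing of NE3∕NE5∕NE9∕NE7 discharged.
[folklore] -/
theorem uRateUpTo_occCarriers_of_hmin {L N : ℕ} (hL : 2 ≤ L) (hN : 1 ≤ N) {θ : ℝ} (hθ : 0 < θ)
    (hθ6 : θ ^ 6 = ((L : ℝ))⁻¹) {ε b c : ℝ} (hb : 0 ≤ b) (hbε : b ≤ ε)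
    (hbs : 512 * (4 + 1) * (4 + 4) * (L : ℝ) ^ 2 * b ≤ 1)
    (hε1 : 16 * C0 4 * ε ≤ 3) (h2line : 2 * twoLevelSmall 4 L * ε ≤ (L : ℝ) ^ 2)
    {g C Λ₁ Λ₂' : ℝ} (hgc : gradConst 4 c ≤ g) (hC : 0 ≤ C) (hΛ₂' : 0 < Λ₂')
    {dom : Set (Site 4 → Fin 4 → (Matrix n n ℂ)ˣ)}
    (hdom : ∀ v ∈ dom, ∀ w : Site 4 → (Matrix n n ℂ)ˣ, IsUnitarySite w → IsPeriodicSite w (N : ℤ) → gaugeAct w v ∈ dom)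
    (hmin : ∀ V ∈ dom, ∀ k : ℕ, ∃ U, IsMinimiser 4 (sfClass 4 L N ε) L N k V U ∧ RegularSup 4 L N b c k U)
    (h : ∀ k : ℕ, 1 ≤ k → ∀ V ∈ dom, ∀ UA UB : Site 4 → Fin 4 → (Matrix n n ℂ)ˣ,
      IsMinimiser 4 (sfClass 4 L N ε) L N k V UA → IsMinimiser 4 (sfClass 4 L N ε) L N (k + 1) V UB →
        Regular 4 L N b g (k + 1) UB →
        ∃ (u : Site 4 → (Matrix n n ℂ)ˣ) (Z : Site 4 → Fin 4 → Matrix n n ℂ),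
          IsUnitarySite u ∧ IsPeriodicSite u ((N * L ^ k : ℕ) : ℤ) ∧
          IsSkewDir Z ∧ IsPeriodicDir Z ((N * L ^ k : ℕ) : ℤ) ∧
          gaugeAct u UA = vary (rescale L (bavg L UB)) Z 1 ∧
          energyNormW L k (rescale L (bavg L UB)) Z (periodBox (N * L ^ k)) ≤ C * residualScale 4 L N b g k ∧
          (∀ (κ : Fin 4) (x : Site 4) (μ : Fin 4),
            ‖Ad (rescale L (bavg L UB) (x + e κ) μ) (Z (x + e μ) κ) - Z x κ‖ ≤ Λ₁ * (((L : ℝ)⁻¹) ^ k) ^ 2) ∧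
          (∀ (κ μ : Fin 4) (y : Site 4),
            ‖Ad (rescale L (bavg L UB) (y + e κ) μ)
                (Ad (rescale L (bavg L UB) (y + e κ + e μ) μ) (Z (y + (2 : ℕ) • e μ) κ) - Z (y + e μ) κ)
              - (Ad (rescale L (bavg L UB) (y + e κ) μ) (Z (y + e μ) κ) - Z y κ)‖ ≤ Λ₂' * (((L : ℝ)⁻¹) ^ k) ^ 3))
    {γ l₁ : ℝ} (hγ : 0 < γ)
    (hγ3 : C * (wallConst 4 L * (N : ℝ) ^ 2 * (Real.sqrt g * dualC2 4 L + 2 * b ^ 2 * dualC1 4 L)) ≤ γ ^ 3)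
    (hl₁ : 0 < l₁) (hΛl₁ : Λ₁ ≤ l₁ ^ 3)
    (hsector : (Fintype.card n : ℝ) * (N : ℝ) ^ 2 * ε ≤ sectorConst n)
    (D : Type) (sc : D → ℕ) (dl : D → ℝ) (hdl : ∀ X, 0 ≤ dl X)
    -- node U3's shapes on the carrier, node U2's output, the window, the common rate
    {W : Set (ℕ → ℝ)} {EA : Functional (occCarriers n L N ε dom D sc dl hdl) (occCarriers n L N ε dom D sc dl hdl).BgA}
    {EB : Functional (occCarriers n L N ε dom D sc dl hdl) (occCarriers n L N ε dom D sc dl hdl).BgB}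
    {κ θ₅ C₅ C₉ ω θc Cd γg P θ' : ℝ} {q : ℕ} {Λ : ℕ → ℕ → ℝ} {CU : (ℕ → ℝ) → ℕ → ℝ} {gtab : ℕ → ℕ → ℝ}
    (h9 : NE9 EA W κ Λ) (hΛ : FadingMemory C₉ ω Λ) (hω : 0 ≤ ω)
    (hU : LipBackground EA W κ CU) (hG : PolyLipGrowth CU gtab P q) (hP : 0 ≤ P)
    (h5 : NE5 EA EB W κ θ₅ C₅) (hθ₅ : 0 ≤ θ₅) (hC₅ : 0 ≤ C₅)
    (hinj : InjectedRate Cd 0 θc (fun K j => T4CouplingMatching.disc (gtab K) (gtab (K + 1)) j)) (hCd : 0 ≤ Cd)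
    (hθc : 0 ≤ θc) (hbox : ∀ K i, i ≤ K → 0 < gtab K i ∧ gtab K i ≤ γg)
    (hgA : ∀ K, gtab K ∈ W) (hgB : ∀ K, (fun i => gtab (K + 1) (i + 1)) ∈ W)
    (hθ' : max ω θc < θ') (hθ₅' : θ₅ ≤ θ') (hθθ' : θ ≤ θ') :
    ∃ (uA : ℕ → (Site 4 → Fin 4 → (Matrix n n ℂ)ˣ) → (occCarriers n L N ε dom D sc dl hdl).BgA)
      (uB : ℕ → (Site 4 → Fin 4 → (Matrix n n ℂ)ˣ) → (occCarriers n L N ε dom D sc dl hdl).BgB) (K₀ : ℕ) (a : ℝ),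
      0 ≤ a ∧
      (∀ K : ℕ, K₀ ≤ K → ∀ v ∈ dom, ∃ (UA UB : Site 4 → Fin 4 → (Matrix n n ℂ)ˣ) (wA wB : Site 4 → (Matrix n n ℂ)ˣ),
        IsMinimiser 4 (sfClass 4 L N ε) L N K v UA ∧ IsMinimiser 4 (sfClass 4 L N ε) L N (K + 1) v UB ∧
        Regular 4 L N b g (K + 1) UB ∧ IsUnitarySite wA ∧ IsPeriodicSite wA ((N * L ^ K : ℕ) : ℤ) ∧
        IsUnitarySite wB ∧ IsPeriodicSite wB ((N * L ^ (K + 1) : ℕ) : ℤ) ∧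
        (uA K v).1 = (K, gaugeAct wA UA) ∧ (uB K v).1 = (K, gaugeAct wB UB)) ∧
      (∀ (K : ℕ) (v : Site 4 → Fin 4 → (Matrix n n ℂ)ˣ), ¬ (K₀ ≤ K ∧ v ∈ dom) →
        (uA K v).1 = (K, 1) ∧ (uB K v).1 = (K, 1)) ∧
      ∀ K : ℕ, URateUpTo K EA EB (gtab K) (fun i => gtab (K + 1) (i + 1)) (uA K) (uB K) dom
        (a + C₉ * (γg ^ 3 * Cd) * (θ' / (θ' - max ω θc)) + C₅) θ' κ := by
  obtain ⟨uA, uB, K₀, C₃, hC₃, hspec, hdef, hclose⟩ := hclose_of_hmin hL hN hθ hθ6 hb hbε hbs hε1 h2line hgc hC hΛ₂' hdom hmin h hγ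
    hγ3 hl₁ hΛl₁ hsector D sc dl hdl
  obtain ⟨a, ha, hrate⟩ := uRateUpTo_of_hclose h9 hΛ hω hU hG hP h5 hθ₅ hC₅ hclose hC₃ hθ.le (theta_lt_one hL hθ hθ6) hinj hCd
    hθc hbox hgA hgB hθ' hθ₅' hθθ'
  exact ⟨uA, uB, K₀, a, ha, hspec, hdef, hrate⟩

/-! ## §4 The old bill implies the new one -/

/-- **p310675's HYPOTHESES IMPLY (H∃)** (`d = 4`): under the universal (H3ˢᵘᵖ) `h3` for the `sfClass`-minimisers of runs `k+1`, the data class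
`dom ⊆ sfClass 4 L N ε₁ 0` (`ε₁ ≤ 1∕4`, `ε₁ ≤ b`, `4ε₁ ≤ c`), radii `0 ≤ b, c ≤ t` with `2^91·L^17·t ≤ 1` and `2^76·L^12·t ≤ ε`, and the compactness
regime `16·C₀·ε ≤ 3`, `1024·5·8·L²·ε ≤ 1` (`L ≥ 2`) — ALL of them binders of `NE7EtaBackgroundLevelSmallDischarge.hclose_of_regularSup_lines` — the
binder `hmin` of `hclose_of_hmin` holds (`NE7EtaBackgroundRefineThresholds.exists_regular_isMinimiser_thm1Type` ∘ `thresholds_four` ∘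
`classRadius_four`).  So p310675 = `hclose_of_hmin` ∘ this, and the re-cut generalises it. [folklore] -/
theorem hmin_of_regularSup_four {L N : ℕ} (hL : 2 ≤ L) {b c t ε ε₁ : ℝ} (hb : 0 ≤ b) (hc : 0 ≤ c) (hbt : b ≤ t) (hct : c ≤ t)
    (hsmall : (2 : ℝ) ^ 91 * (L : ℝ) ^ 17 * t ≤ 1) (hεt : (2 : ℝ) ^ 76 * (L : ℝ) ^ 12 * t ≤ ε)
    (hε1 : 16 * C0 4 * ε ≤ 3) (hε2 : 1024 * (4 + 1) * (4 + 4) * (L : ℝ) ^ 2 * ε ≤ 1)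
    (hε₁ : ε₁ ≤ 1 / 4) (hε₁b : ε₁ ≤ b) (hε₁c : 4 * ε₁ ≤ c)
    {dom : Set (Site 4 → Fin 4 → (Matrix n n ℂ)ˣ)} (hdom1 : dom ⊆ sfClass 4 L N ε₁ 0)
    (h3 : ∀ V ∈ dom, ∀ (k : ℕ) (U : Site 4 → Fin 4 → (Matrix n n ℂ)ˣ),
      IsMinimiser 4 (sfClass 4 L N ε) L N (k + 1) V U → RegularSup 4 L N b c (k + 1) U) :
    ∀ V ∈ dom, ∀ k : ℕ, ∃ U, IsMinimiser 4 (sfClass 4 L N ε) L N k V U ∧ RegularSup 4 L N b c k U := by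
  have hL1 : 1 ≤ L := le_trans (by norm_num) hL
  have ht0 : 0 ≤ t := hb.trans hbt
  obtain ⟨hT1, hT2, hT3⟩ := thresholds_four hL1 ht0 hsmall
  have hE := classRadius_four hL1 ht0 hεt
  have hε2' : 1024 * ((4 : ℕ) + 1) * ((4 : ℕ) + 4) * (L : ℝ) ^ 2 * ε ≤ 1 := by
    simpa using hε2
  exact exists_regular_isMinimiser_thm1Type (d := 4) (n := n) (by norm_num) hL hb hc hbt hct hT1 hT2 hT3 hE hε1 hε2' hε₁ hε₁b hε₁c
    hdom1 h3

end

end Summit.QuantumFields.BalabanUV.T4Continuum.NE7EtaBackgroundOfRegularMinimisers
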